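import Mathlib
import HarnessLib
import Summits.HubbardSuperconductivity.HubbardSuperconductivity.Theorems.KLProgrammeC4aTadpoleRepresentation
import Summits.HubbardSuperconductivity.HubbardSuperconductivity.Theorems.KLProgrammeC4aSliceTransform
import Summits.HubbardSuperconductivity.HubbardSuperconductivity.Theorems.KLProgrammeC4aSliceProfile
import Summits.HubbardSuperconductivity.HubbardSuperconductivity.Theorems.KLProgrammeC4aInvariantDefs

/-!
# Route `KLProgramme` — crux C4a, THE TADPOLE REPRESENTATION, tube form: the continuum tadpole is the TUBE TADPOLE of `…C4aTubeTadpoleCert`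
# (profile `ŝ(ω_{p₀}, ·)`, vertex `tadpoleVertex`) up to an aliasing error of size `(Σ_y‖𝒟_{p₀}(P,y)‖)·tail`, with `Σ_y‖𝒟‖ ≤ 12|β|L⁴|Λ|⁻⁴Σ_{σ,τ}Σ_x‖W₄(x)‖`

Cell `gate-hubbard-kl`, lane hubbard-kl-c4a-1 (g5); helper for stub (C) `stub_twoLeg_curvature` of the engine-flow child `KLRegimeEngineV17F2`
(stmt-HubbardSuperconductivity-20437); memo HOME/hubbard-kl-c4a-1/C4A-PLAN.md §16.4 (4)–(6), §16.5 (iv)–(v).  Continues `…C4aTadpoleRepresentation`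
(`localReadingCont β (Δ_S W) P = tadpoleCont … P` at every continuum momentum):

* §1 **`norm_tadpoleSlice_sub_tubeIntegral_le`** — per slice frequency `p₀` and external momentum `P`:
  `‖Σ_y 𝒟_{p₀}(P,y)·L⁻²S_{p₀}(y) − (2π)⁻²∫_{tube} ŝ(ω_{p₀}, e_K q)·tadpoleVertex β W p₀ (P, q) dq‖ ≤ (Σ_y‖𝒟_{p₀}(P,y)‖)·D/(2π)^M·(2/L)^{M−4}·4C₂`
  (`…C4aSliceTransform.norm_sum_coeff_mul_sliceTransform_sub_tubeIntegral_le` with `…C4aSliceProfile`'s smoothness/support of the slice profile; `0 < Λ ≤ Λ′ < r`,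
  `‖D^M(ŝ∘e_K∘2π·)‖ ≤ D`, `M ≥ 4`), and the sum over the kept frequencies **`norm_tadpoleCont_sub_tubeTadpoles_le`**;
* §2 `sum_norm_loopCoeffCont_le`, **`sum_norm_tadpoleCoeff_le`** — the coefficient mass, uniformly in the external momentum:
  `Σ_y ‖𝒟_{p₀}(P, y)‖ ≤ 6|β|L⁴·Σ_{σ,τ} 2·|Λ|⁻⁴Σ_x ‖W₄^{σ,τ}(x)‖` (plane waves and time phases are unimodular; the fibres partition the position tuples);
* §3 **`contDiff_tadpoleVertex`** — the vertex is jointly `C^∞` on `Momentum × Momentum` (a trigonometric polynomial in both slots): the `hV` of the tube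
  tadpole-jet theorem; `tadpoleVertex_levelPoint` (its value at the frame's Fermi point reads the coefficients at `klFermiPoint μ K θ`).

So the one-line term of `klLocalPart_succ_sub_eq_avg8` at each of the eight Fermi points is `Σ_{p₀}(2π)⁻²∫_{tube} ŝ_{p₀}(e_K q)·V_{p₀}(Φ(0,θ′), q)dq` — literally
the integral of `norm_iteratedDeriv_tubeTadpole_le_cert` / `norm_tubeTadpole_pair_le` — plus `Σ_{p₀,y} 𝒟_{p₀}(k_F(θ′), y)·e_{p₀,y}` with θ′-FREE errors
`‖e_{p₀,y}‖ ≤ tail` (`norm_sliceTransform_sub_tubeFourier_le`), whose angular jets cost only the jets of `θ′ ↦ 𝒟_{p₀}(k_F(θ′), y)`.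
Estimates by composition; nothing is asserted about the Hubbard model's sizes; nothing asserts superconductivity.
References: BGM 2006 §2.3 (2.17)–(2.23), §2.4 (2.36) [cite: BenfattoGiulianiMastropietro2006]; Boyd 2001 §4.5 Thm 20 [cite: Boyd2001].
-/

noncomputable section

namespace Summit.HubbardSuperconductivity.HubbardSuperconductivity.Theorems.C4a

set_option linter.dupNamespace false -- summit = problem name (single-conjunct summit), D-0017

open Real Set MeasureTheory Finset
open scoped ContDiff
open Literature.MathematicalPhysics.QuantumLattice Literature.Probability.LatticeModels GrassmannAlgebra
open Summit.HubbardSuperconductivity.HubbardSuperconductivity.Theorems.KLRegimeSplit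
open Summit.HubbardSuperconductivity.HubbardSuperconductivity.Theorems.DispersionFlow

variable {L M : ℕ} [NeZero L] [NeZero M]

/-! ## §1 The Poisson step: continuum tadpole = tube tadpoles + aliasing -/

/-- **ONE SLICE FREQUENCY**: the `p₀`-term of `tadpoleCont` is the tube tadpole of the profile `ŝ_{Λ,Λ′}(ω_{p₀}, ·)` and the vertex `tadpoleVertex β W p₀`
up to `(Σ_y‖𝒟_{p₀}(P,y)‖)·D/(2π)^M·(2/L)^{M−4}·4C₂` (`β ≠ 0`, `0 < Λ ≤ Λ′ < r`, `‖D^M(ŝ(ω_{p₀}, e_K(2π·)))‖ ≤ D`, `M ≥ 4`).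
[cite: Boyd2001, §4.5 Theorem 20 (4.47)] -/
theorem norm_tadpoleSlice_sub_tubeIntegral_le {β : ℝ} (hβ : β ≠ 0) (μ : ℝ) (K : TrigPolyC4v) {Λ Λ' r : ℝ} (hΛ : 0 < Λ) (hΛΛ' : Λ ≤ Λ')
    (hr : Λ' < r) (W : HubbardGrassmann L M) (p₀ : MatsubaraIdx M) (P : Fin 2 → ℝ) {Mdeg : ℕ} (hM : 4 ≤ Mdeg) {D : ℝ}
    (hD : ∀ y : Momentum, ‖iteratedFDeriv ℝ Mdeg (fun y : Momentum =>
      sliceSymbolFnXi (β * (L : ℝ) ^ 2) 0 Λ Λ' (matsubaraFreq β M p₀) (frameLevel μ K ((2 * π) • y))) y‖ ≤ D) :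
    ‖∑ y : TorusSite 2 L, tadpoleCoeff β W p₀ P y *
          (((L : ℂ) ^ 2)⁻¹ * ∑ q : TorusSite 2 L,
            sliceSymbolFnXi (β * (L : ℝ) ^ 2) 0 Λ Λ' (matsubaraFreq β M p₀) (frameLevel μ K (WithLp.toLp 2 (latticeMomentum L q))) * torusChar q y) -
        ((2 * π) ^ 2)⁻¹ • ∫ p in {q : ℝ × ℝ | |q.1| < π ∧ |q.2| < π ∧ |frameLevel μ K (WithLp.toLp 2 ![q.1, q.2])| < r},
          sliceSymbolFnXi (β * (L : ℝ) ^ 2) 0 Λ Λ' (matsubaraFreq β M p₀) (frameLevel μ K (WithLp.toLp 2 ![p.1, p.2])) *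
            tadpoleVertex β W p₀ (WithLp.toLp 2 P) (WithLp.toLp 2 ![p.1, p.2])‖ ≤
      (∑ y : TorusSite 2 L, ‖tadpoleCoeff β W p₀ P y‖) *
        (D / (2 * Real.pi) ^ Mdeg * (2 / (L : ℝ)) ^ (Mdeg - 4) * (4 * ∑' k : Fin 2 → ℤ, ∏ j, (1 + (k j : ℝ) ^ 2)⁻¹)) := by
  simp_rw [tadpoleVertex_apply_toLp]
  exact norm_sum_coeff_mul_sliceTransform_sub_tubeIntegral_le μ K (sliceSymbolFnXi_matsubara_contDiff hβ L M p₀ Λ Λ')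
    (sliceSymbolFnXi_matsubara_tsupport_subset L M p₀ hΛ hΛΛ' hr) hM hD _

/-- **THE CONTINUUM TADPOLE IS THE SUM OF THE TUBE TADPOLES OVER THE KEPT FREQUENCIES, UP TO ALIASING** (`β ≠ 0`, `0 < Λ ≤ Λ′ < r`, a derivative table
`D p₀` for each profile, `M ≥ 4`): `‖tadpoleCont … P − Σ_{p₀}(2π)⁻²∫_{tube} ŝ_{p₀}(e_K q)·V_{p₀}(P, q)dq‖ ≤ Σ_{p₀}(Σ_y‖𝒟_{p₀}(P,y)‖)·D_{p₀}/(2π)^M·(2/L)^{M−4}·4C₂`.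
[cite: Boyd2001, §4.5 Theorem 20 (4.47)] -/
theorem norm_tadpoleCont_sub_tubeTadpoles_le {β : ℝ} (hβ : β ≠ 0) (μ : ℝ) (K : TrigPolyC4v) {Λ Λ' r : ℝ} (hΛ : 0 < Λ) (hΛΛ' : Λ ≤ Λ')
    (hr : Λ' < r) (W : HubbardGrassmann L M) (P : Fin 2 → ℝ) {Mdeg : ℕ} (hM : 4 ≤ Mdeg) {D : MatsubaraIdx M → ℝ}
    (hD : ∀ (p₀ : MatsubaraIdx M) (y : Momentum), ‖iteratedFDeriv ℝ Mdeg (fun y : Momentum =>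
      sliceSymbolFnXi (β * (L : ℝ) ^ 2) 0 Λ Λ' (matsubaraFreq β M p₀) (frameLevel μ K ((2 * π) • y))) y‖ ≤ D p₀) :
    ‖tadpoleCont β μ K Λ Λ' W P -
        ∑ p₀ : MatsubaraIdx M, ((2 * π) ^ 2)⁻¹ • ∫ p in {q : ℝ × ℝ | |q.1| < π ∧ |q.2| < π ∧ |frameLevel μ K (WithLp.toLp 2 ![q.1, q.2])| < r},
          sliceSymbolFnXi (β * (L : ℝ) ^ 2) 0 Λ Λ' (matsubaraFreq β M p₀) (frameLevel μ K (WithLp.toLp 2 ![p.1, p.2])) *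
            tadpoleVertex β W p₀ (WithLp.toLp 2 P) (WithLp.toLp 2 ![p.1, p.2])‖ ≤
      ∑ p₀ : MatsubaraIdx M, (∑ y : TorusSite 2 L, ‖tadpoleCoeff β W p₀ P y‖) *
        (D p₀ / (2 * Real.pi) ^ Mdeg * (2 / (L : ℝ)) ^ (Mdeg - 4) * (4 * ∑' k : Fin 2 → ℤ, ∏ j, (1 + (k j : ℝ) ^ 2)⁻¹)) := by
  unfold tadpoleCont
  rw [← Finset.sum_sub_distrib]
  exact (norm_sum_le _ _).trans (Finset.sum_le_sum fun p₀ _ => norm_tadpoleSlice_sub_tubeIntegral_le hβ μ K hΛ hΛΛ' hr W p₀ P hM (hD p₀))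

/-! ## §2 The coefficient mass, uniformly in the external momentum -/

omit [NeZero M] in
/-- **`Σ_y ‖loopCoeffCont … P y‖ ≤ |Λ|⁻⁴·Σ_x ‖W₄(x)‖`** (time phases and the plane wave are unimodular; the fibres `x⃗₃ − x⃗₂ = y` partition the tuples).
[cite: BenfattoGiulianiMastropietro2006, §2.3 (2.17)] -/
theorem sum_norm_loopCoeffCont_le (β : ℝ) (W : HubbardGrassmann L M) (κ p₀ : MatsubaraIdx M) (σ τ : Fin 2) (P : Fin 2 → ℝ) :
    ∑ y : TorusSite 2 L, ‖loopCoeffCont β W κ p₀ σ τ P y‖ ≤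
      ((Fintype.card (SpaceTimeIdx L M) : ℝ) ^ 4)⁻¹ *
        ∑ x : Fin 4 → SpaceTimeIdx L M, ‖positionKernel L M β W 4 (fun i => ((x i, ![σ, σ, τ, τ] i), (![0, 1, 1, 0] : Fin 4 → Fin 2) i))‖ := by
  have hunit : ∀ x : Fin 4 → SpaceTimeIdx L M,
      ‖Complex.exp (((matsubaraFreq β M κ * (imagTime β M (x 0).1 - imagTime β M (x 1).1) : ℝ) : ℂ) * Complex.I) *
          Complex.exp (((∑ j, P j * ((((x 0).2 - (x 1).2) j).valMinAbs : ℝ) : ℝ) : ℂ) * Complex.I) *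
          Complex.exp (((matsubaraFreq β M p₀ * (imagTime β M (x 3).1 - imagTime β M (x 2).1) : ℝ) : ℂ) * Complex.I)‖ = 1 := by
    intro x
    rw [norm_mul, norm_mul, Complex.norm_exp_ofReal_mul_I, Complex.norm_exp_ofReal_mul_I, Complex.norm_exp_ofReal_mul_I]
    norm_num
  unfold loopCoeffCont
  calc ∑ y : TorusSite 2 L, ‖(((Fintype.card (SpaceTimeIdx L M) : ℂ) ^ 4)⁻¹ *
          ∑ x ∈ (Finset.univ : Finset (Fin 4 → SpaceTimeIdx L M)).filter (fun x => (x 3).2 - (x 2).2 = y),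
            positionKernel L M β W 4 (fun i => ((x i, ![σ, σ, τ, τ] i), (![0, 1, 1, 0] : Fin 4 → Fin 2) i)) *
              (Complex.exp (((matsubaraFreq β M κ * (imagTime β M (x 0).1 - imagTime β M (x 1).1) : ℝ) : ℂ) * Complex.I) *
                Complex.exp (((∑ j, P j * ((((x 0).2 - (x 1).2) j).valMinAbs : ℝ) : ℝ) : ℂ) * Complex.I) *
                Complex.exp (((matsubaraFreq β M p₀ * (imagTime β M (x 3).1 - imagTime β M (x 2).1) : ℝ) : ℂ) * Complex.I)))‖
      ≤ ∑ y : TorusSite 2 L, ((Fintype.card (SpaceTimeIdx L M) : ℝ) ^ 4)⁻¹ *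
          ∑ x ∈ (Finset.univ : Finset (Fin 4 → SpaceTimeIdx L M)).filter (fun x => (x 3).2 - (x 2).2 = y),
            ‖positionKernel L M β W 4 (fun i => ((x i, ![σ, σ, τ, τ] i), (![0, 1, 1, 0] : Fin 4 → Fin 2) i))‖ := by
        refine Finset.sum_le_sum fun y _ => ?_
        rw [norm_mul, norm_inv, norm_pow, Complex.norm_natCast]
        refine mul_le_mul_of_nonneg_left ((norm_sum_le _ _).trans (Finset.sum_le_sum fun x _ => ?_)) (by positivity)
        rw [norm_mul, hunit, mul_one]
    _ = ((Fintype.card (SpaceTimeIdx L M) : ℝ) ^ 4)⁻¹ *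
          ∑ x : Fin 4 → SpaceTimeIdx L M, ‖positionKernel L M β W 4 (fun i => ((x i, ![σ, σ, τ, τ] i), (![0, 1, 1, 0] : Fin 4 → Fin 2) i))‖ := by
        rw [← Finset.mul_sum, Finset.sum_fiberwise Finset.univ (fun x : Fin 4 → SpaceTimeIdx L M => (x 3).2 - (x 2).2)]

/-- **THE TADPOLE COEFFICIENT MASS** (uniform in the external momentum `P`):
`Σ_y ‖𝒟_{p₀}(P, y)‖ ≤ 6|β|L⁴·Σ_{σ,τ} 2·|Λ|⁻⁴·Σ_x ‖W₄^{σ,τ}(x)‖` — a POSITION-SPACE kernel norm of the input (the (b)-tower's currency).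
[cite: BenfattoGiulianiMastropietro2006, §2.3 (2.17)] -/
theorem sum_norm_tadpoleCoeff_le (β : ℝ) (W : HubbardGrassmann L M) (p₀ : MatsubaraIdx M) (P : Fin 2 → ℝ) :
    ∑ y : TorusSite 2 L, ‖tadpoleCoeff β W p₀ P y‖ ≤
      6 * |β| * (L : ℝ) ^ 4 * ∑ σ : Fin 2, ∑ τ : Fin 2, 2 * (((Fintype.card (SpaceTimeIdx L M) : ℝ) ^ 4)⁻¹ *
        ∑ x : Fin 4 → SpaceTimeIdx L M, ‖positionKernel L M β W 4 (fun i => ((x i, ![σ, σ, τ, τ] i), (![0, 1, 1, 0] : Fin 4 → Fin 2) i))‖) := by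
  have hK : ‖((6 * β * (L : ℝ) ^ 4 : ℝ) : ℂ)‖ = 6 * |β| * (L : ℝ) ^ 4 := by
    rw [Complex.norm_real, Real.norm_eq_abs, abs_mul, abs_mul, abs_of_nonneg (by norm_num : (0 : ℝ) ≤ 6),
      abs_of_nonneg (by positivity : (0 : ℝ) ≤ (L : ℝ) ^ 4)]
  unfold tadpoleCoeff
  calc ∑ y : TorusSite 2 L, ‖((6 * β * (L : ℝ) ^ 4 : ℝ) : ℂ) *
          ∑ σ : Fin 2, ∑ τ : Fin 2, ∑ κ : Fin 2, loopCoeffCont β W ((![omega0 M, (omega0 M).rev] : Fin 2 → MatsubaraIdx M) κ) p₀ σ τ P y‖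
      ≤ ∑ y : TorusSite 2 L, 6 * |β| * (L : ℝ) ^ 4 *
          ∑ σ : Fin 2, ∑ τ : Fin 2, ∑ κ : Fin 2, ‖loopCoeffCont β W ((![omega0 M, (omega0 M).rev] : Fin 2 → MatsubaraIdx M) κ) p₀ σ τ P y‖ := by
        refine Finset.sum_le_sum fun y _ => ?_
        rw [norm_mul, hK]
        refine mul_le_mul_of_nonneg_left ((norm_sum_le _ _).trans (Finset.sum_le_sum fun σ _ =>
          (norm_sum_le _ _).trans (Finset.sum_le_sum fun τ _ => norm_sum_le _ _))) (by positivity)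
    _ = 6 * |β| * (L : ℝ) ^ 4 * ∑ σ : Fin 2, ∑ τ : Fin 2, ∑ κ : Fin 2,
          ∑ y : TorusSite 2 L, ‖loopCoeffCont β W ((![omega0 M, (omega0 M).rev] : Fin 2 → MatsubaraIdx M) κ) p₀ σ τ P y‖ := by
        rw [← Finset.mul_sum, Finset.sum_comm]
        congr 1
        refine Finset.sum_congr rfl fun σ _ => ?_
        rw [Finset.sum_comm]
        refine Finset.sum_congr rfl fun τ _ => ?_
        rw [Finset.sum_comm]
    _ ≤ 6 * |β| * (L : ℝ) ^ 4 * ∑ σ : Fin 2, ∑ τ : Fin 2, 2 * (((Fintype.card (SpaceTimeIdx L M) : ℝ) ^ 4)⁻¹ *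
          ∑ x : Fin 4 → SpaceTimeIdx L M, ‖positionKernel L M β W 4 (fun i => ((x i, ![σ, σ, τ, τ] i), (![0, 1, 1, 0] : Fin 4 → Fin 2) i))‖) := by
        refine mul_le_mul_of_nonneg_left (Finset.sum_le_sum fun σ _ => Finset.sum_le_sum fun τ _ => ?_) (by positivity)
        simp only [Fin.sum_univ_two, Matrix.cons_val_zero, Matrix.cons_val_one, two_mul]
        exact add_le_add (sum_norm_loopCoeffCont_le β W _ p₀ σ τ P) (sum_norm_loopCoeffCont_le β W _ p₀ σ τ P)

/-! ## §3 The vertex is jointly smooth; its value at the frame's Fermi point -/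

/-- **The tadpole vertex is jointly `C^∞` on `Momentum × Momentum`** (a finite sum of products of plane waves with constant coefficients) — the `hV` of
`…C4aTubeTadpoleCert.norm_iteratedDeriv_tubeTadpole_le_cert` and of `…C4aTubeTadpoleValue.norm_tubeTadpole_pair_le`. -/
theorem contDiff_tadpoleVertex (β : ℝ) (W : HubbardGrassmann L M) (p₀ : MatsubaraIdx M) :
    ContDiff ℝ ∞ fun x : Momentum × Momentum => tadpoleVertex β W p₀ x.1 x.2 := by
  have h1 : ∀ j : Fin 2, ContDiff ℝ ∞ (fun x : Momentum × Momentum => (WithLp.ofLp x.1) j) := fun j =>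
    (EuclideanSpace.proj (𝕜 := ℝ) j).contDiff.comp contDiff_fst
  have h2 : ∀ i : Fin 2, ContDiff ℝ ∞ (fun x : Momentum × Momentum => x.2 i) := fun i =>
    (EuclideanSpace.proj (𝕜 := ℝ) i).contDiff.comp contDiff_snd
  have hpw1 : ∀ z : TorusSite 2 L, ContDiff ℝ ∞ (fun x : Momentum × Momentum =>
      Complex.exp (((∑ j, (WithLp.ofLp x.1) j * ((z j).valMinAbs : ℝ) : ℝ) : ℂ) * Complex.I)) := by
    intro z
    have hs : ContDiff ℝ ∞ (fun x : Momentum × Momentum => (∑ j, (WithLp.ofLp x.1) j * ((z j).valMinAbs : ℝ) : ℝ)) :=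
      ContDiff.sum fun j _ => (h1 j).mul contDiff_const
    have hc : ContDiff ℝ ∞ (fun x : Momentum × Momentum => (((∑ j, (WithLp.ofLp x.1) j * ((z j).valMinAbs : ℝ) : ℝ) : ℂ))) :=
      Complex.ofRealCLM.contDiff.comp hs
    exact Complex.contDiff_exp.comp (hc.mul contDiff_const)
  have hpw2 : ∀ y : TorusSite 2 L, ContDiff ℝ ∞ (fun x : Momentum × Momentum =>
      Complex.exp (((∑ i, ((y i).valMinAbs : ℝ) * x.2 i : ℝ) : ℂ) * Complex.I)) := by
    intro y
    have hs : ContDiff ℝ ∞ (fun x : Momentum × Momentum => (∑ i, ((y i).valMinAbs : ℝ) * x.2 i : ℝ)) :=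
      ContDiff.sum fun i _ => contDiff_const.mul (h2 i)
    have hc : ContDiff ℝ ∞ (fun x : Momentum × Momentum => (((∑ i, ((y i).valMinAbs : ℝ) * x.2 i : ℝ) : ℂ))) :=
      Complex.ofRealCLM.contDiff.comp hs
    exact Complex.contDiff_exp.comp (hc.mul contDiff_const)
  have hloop : ∀ (κ : MatsubaraIdx M) (σ τ : Fin 2) (y : TorusSite 2 L),
      ContDiff ℝ ∞ (fun x : Momentum × Momentum => loopCoeffCont β W κ p₀ σ τ (WithLp.ofLp x.1) y) := by
    intro κ σ τ y
    unfold loopCoeffCont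
    exact contDiff_const.mul (ContDiff.sum fun x _ => contDiff_const.mul ((contDiff_const.mul (hpw1 _)).mul contDiff_const))
  have hcoeff : ∀ y : TorusSite 2 L, ContDiff ℝ ∞ (fun x : Momentum × Momentum => tadpoleCoeff β W p₀ (WithLp.ofLp x.1) y) := by
    intro y
    unfold tadpoleCoeff
    exact contDiff_const.mul (ContDiff.sum fun σ _ => ContDiff.sum fun τ _ => ContDiff.sum fun κ _ => hloop _ σ τ y)
  unfold tadpoleVertex
  exact ContDiff.sum fun y _ => (hcoeff y).mul (hpw2 y)

/-- **At the frame's Fermi point**: `tadpoleVertex … (levelPoint μ K 0 θ) q = Σ_y 𝒟_{p₀}(klFermiPoint μ K θ, y)·e^{iq·ỹ}` — the `V (levelPoint μ K 0 θ) q` slot of the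
tube tadpole-jet theorem reads the tadpole coefficients at `k_F^K(θ)`, i.e. the `P := klFermiPoint μ K θ′` of `localReadingCont_laplacian_eq_tadpoleCont` /
`klLocalPart_succ_sub_eq_avg8`. -/
theorem tadpoleVertex_levelPoint (β μ : ℝ) (K : TrigPolyC4v) (W : HubbardGrassmann L M) (p₀ : MatsubaraIdx M) (θ : ℝ) (q : Momentum) :
    tadpoleVertex β W p₀ (levelPoint μ K 0 θ) q =
      ∑ y : TorusSite 2 L, tadpoleCoeff β W p₀ (klFermiPoint μ K θ) y * Complex.exp (((∑ i, ((y i).valMinAbs : ℝ) * q i : ℝ) : ℂ) * Complex.I) := by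
  rw [levelPoint_zero, tadpoleVertex_apply_toLp]

/-- **THE REPRESENTATION AT A FERMI POINT, value level** (`β ≠ 0`, `0 < Λ ≤ Λ′ < r`, tables `D p₀`, `M ≥ 4`): the one-line reading of `klLocalPart_succ_sub_eq_avg8`
at the angle `θ′` is the sum over the kept frequencies of the TUBE TADPOLES of `…C4aTubeTadpoleCert` (profile `ŝ_{p₀}`, vertex `tadpoleVertex β W p₀`,
external point `levelPoint μ K 0 θ′`) up to `Σ_{p₀}(Σ_y‖𝒟_{p₀}(k_F(θ′),y)‖)·tail_{p₀}`. [cite: BenfattoGiulianiMastropietro2006, §2.4 (2.36)] -/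
theorem norm_localReadingCont_laplacian_sub_tubeTadpoles_le {β : ℝ} (hβ : β ≠ 0) (μ : ℝ) (K : TrigPolyC4v) {Λ Λ' r : ℝ} (hΛ : 0 < Λ)
    (hΛΛ' : Λ ≤ Λ') (hr : Λ' < r) (W : HubbardGrassmann L M) (θ : ℝ) {Mdeg : ℕ} (hM : 4 ≤ Mdeg) {D : MatsubaraIdx M → ℝ}
    (hD : ∀ (p₀ : MatsubaraIdx M) (y : Momentum), ‖iteratedFDeriv ℝ Mdeg (fun y : Momentum =>
      sliceSymbolFnXi (β * (L : ℝ) ^ 2) 0 Λ Λ' (matsubaraFreq β M p₀) (frameLevel μ K ((2 * π) • y))) y‖ ≤ D p₀) :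
    ‖localReadingCont β (grassmannLaplacian ℂ (hubbardCovSliceCT L M β μ 0 K Λ Λ') W) (klFermiPoint μ K θ) -
        ∑ p₀ : MatsubaraIdx M, ((2 * π) ^ 2)⁻¹ • ∫ p in {q : ℝ × ℝ | |q.1| < π ∧ |q.2| < π ∧ |frameLevel μ K (WithLp.toLp 2 ![q.1, q.2])| < r},
          sliceSymbolFnXi (β * (L : ℝ) ^ 2) 0 Λ Λ' (matsubaraFreq β M p₀) (frameLevel μ K (WithLp.toLp 2 ![p.1, p.2])) *
            tadpoleVertex β W p₀ (levelPoint μ K 0 θ) (WithLp.toLp 2 ![p.1, p.2])‖ ≤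
      ∑ p₀ : MatsubaraIdx M, (∑ y : TorusSite 2 L, ‖tadpoleCoeff β W p₀ (klFermiPoint μ K θ) y‖) *
        (D p₀ / (2 * Real.pi) ^ Mdeg * (2 / (L : ℝ)) ^ (Mdeg - 4) * (4 * ∑' k : Fin 2 → ℤ, ∏ j, (1 + (k j : ℝ) ^ 2)⁻¹)) := by
  rw [localReadingCont_laplacian_eq_tadpoleCont hβ, levelPoint_zero]
  exact norm_tadpoleCont_sub_tubeTadpoles_le hβ μ K hΛ hΛΛ' hr W _ hM hD

end Summit.HubbardSuperconductivity.HubbardSuperconductivity.Theorems.C4a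

end
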